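import Summits.QuantumAdvantage.QuantumAdvantage.Theses.LinnikCubicClassGroups

/-!
# Crux `LinnikCubicClassGroups.PureCubicClassGroupFBQP` (stmt-QuantumAdvantage-11544) — stub `stub_assemblyFields`

Line `arakelov-giant-step-cycle`, stub S6d (skeleton v6): **class numbers and core answers agree across
admissible fields**, from the counts of S4b and the quantum-core family of S5b, by the probabilistic method.

* (2) For a non-cube `m = decodeNat x`, a list `ps` of primes `∤ 3m` and two admissible fields `K, K'`
  (cubic, containing a cube root of `m`), the orders of the subgroups of `Cl(𝓞 K)`, `Cl(𝓞 K')` generated by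
  the degree-one classes above `ps` agree: S5b's `2/3`-event on the well-formed input `⟨x, ⟨f, a, b⟩, ps⟩`
  (a cube-free decomposition `m = f³ab²`, `ab` squarefree, exists — `exists_cubefree_decomposition`) is
  nonempty, and any of its members starts with `bin` of BOTH orders (`boolPair`, `encodeNat` are injective).
* (1) `h(K) = h(K')`: with S4b's constant `C`, `X = (27m²)^C`, `T = 600(log₂X+1)²`, the `T`-tuples of good
  primes whose degree-one classes fail to generate number `≤ 1/8` of all tuples, for `K` and for `K'`; tuples
  exist (S4b (i)); so one tuple generates both class groups (`exists_not_not_of_card`), and by (2) the common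
  order of the generated subgroups is `|Cl(𝓞 K)| = |Cl(𝓞 K')|`.

No isomorphism `K ≃ K'` and no invariance lemma for `classNumber` is used.
-/

set_option linter.dupNamespace false

namespace Summit.QuantumAdvantage.QuantumAdvantage.Theorems.LinnikCubicClassGroups

open Computability (encodeNat decodeNat)
open Literature.Computability.Cryptography (IsQSolvable QCircuitFamily cliffordT)
open Literature.Computability.Complexity (boolPair boolUnpair boolUnpair_boolPair encodingListNatBool)
open scoped NumberField nonZeroDivisors

/-- The order of the top subgroup of the class group is the class number. -/
theorem assemblyFields_card_top (K : Type) [Field K] [NumberField K] :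
    Nat.card (⊤ : Subgroup (ClassGroup (𝓞 K))) = NumberField.classNumber K := by
  rw [Subgroup.card_top, Nat.card_eq_fintype_card]
  rfl

/-- **Cube-free decomposition**: every `m ≠ 0` is `f³·a·b²` with `ab` squarefree (exponents of the prime
factorisation modulo `3`) — the shape of S5b's input promise. -/
theorem assemblyFields_cubefree : ∀ m : ℕ, m ≠ 0 → ∃ f a b : ℕ, m = f ^ 3 * (a * b ^ 2) ∧ Squarefree (a * b) := by
  intro m
  induction m using Nat.recOnPrimePow with
  | zero => intro h; exact absurd rfl h
  | one => intro; exact ⟨1, 1, 1, by norm_num, by norm_num⟩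
  | prime_pow_mul c p n hp hpc hn ih =>
    intro hm
    have hc0 : c ≠ 0 := by rintro rfl; simp at hm
    obtain ⟨f, a, b, rfl, hsq⟩ := ih hc0
    have hpab : ¬ p ∣ a * b := fun h => hpc (h.trans ⟨f ^ 3 * b, by ring⟩)
    have hsq' : Squarefree (p * (a * b)) :=
      Nat.squarefree_mul_iff.2 ⟨(Nat.Prime.coprime_iff_not_dvd hp).2 hpab, hp.prime.squarefree, hsq⟩
    obtain ⟨k, r, hr, rfl⟩ : ∃ k r, r < 3 ∧ n = 3 * k + r :=
      ⟨n / 3, n % 3, Nat.mod_lt _ (by norm_num), (Nat.div_add_mod n 3).symm⟩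
    interval_cases r
    · exact ⟨p ^ k * f, a, b, by ring, hsq⟩
    · exact ⟨p ^ k * f, p * a, b, by ring, by simpa [mul_assoc] using hsq'⟩
    · refine ⟨p ^ k * f, a, p * b, by ring, ?_⟩
      simpa [mul_comm, mul_left_comm, mul_assoc] using hsq'

/-- An event of kernel probability `≥ 2/3` is nonempty. -/
theorem assemblyFields_nonempty {F : QCircuitFamily cliffordT} {w : List Bool} {E : Set (List Bool)}
    (h : (2 : ℝ) / 3 ≤ F.kernelProb 0 w E) : E.Nonempty := by
  by_contra hE
  rw [Set.not_nonempty_iff_eq_empty] at hE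
  subst hE
  simp [QCircuitFamily.kernelProb] at h
  norm_num at h

/-- The set of good primes `≤ X` is finite. -/
theorem assemblyFields_finite (X m : ℕ) : Finite {p : ℕ // p.Prime ∧ p ≤ X ∧ ¬ p ∣ 3 * m} :=
  Finite.of_injective (fun p => (⟨p.1, Nat.lt_succ_of_le p.2.2.1⟩ : Fin (X + 1)))
    fun p q h => Subtype.ext (by simpa using congrArg Fin.val h)

/-- S4b's generating set for the tuple `v` is S5b's generating set for the list `List.ofFn v`. -/
theorem assemblyFields_countSet (K : Type) [Field K] [NumberField K] {X m T : ℕ}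
    (v : Fin T → {p : ℕ // p.Prime ∧ p ≤ X ∧ ¬ p ∣ 3 * m}) :
    {c : ClassGroup (𝓞 K) | ∃ i : Fin T, ∃ P : Ideal (𝓞 K), ∃ hP : P ∈ nonZeroDivisors (Ideal (𝓞 K)),
        P.IsPrime ∧ Ideal.absNorm P = (v i : ℕ) ∧ c = ClassGroup.mk0 ⟨P, hP⟩} =
      {c : ClassGroup (𝓞 K) | ∃ p ∈ List.ofFn (fun i => ((v i : ℕ))), ∃ P : Ideal (𝓞 K),
        ∃ hP : P ∈ nonZeroDivisors (Ideal (𝓞 K)), P.IsPrime ∧ Ideal.absNorm P = p ∧ c = ClassGroup.mk0 ⟨P, hP⟩} := by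
  ext c
  simp only [Set.mem_setOf_eq, List.mem_ofFn]
  constructor
  · rintro ⟨i, P, hP, h1, h2, h3⟩
    exact ⟨_, ⟨i, rfl⟩, P, hP, h1, h2, h3⟩
  · rintro ⟨_, ⟨i, rfl⟩, P, hP, h1, h2, h3⟩
    exact ⟨i, P, hP, h1, h2, h3⟩

/-- Counting: two subsets of a nonempty finite set, each of density `≤ 1/8`, do not cover it. -/
theorem assemblyFields_exists_good {Ω : Type} [Finite Ω] {bad bad' : Ω → Prop} (hΩ : 1 ≤ Nat.card Ω)
    (h1 : 8 * Nat.card {v // bad v} ≤ Nat.card Ω) (h2 : 8 * Nat.card {v // bad' v} ≤ Nat.card Ω) :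
    ∃ v, ¬ bad v ∧ ¬ bad' v := by
  by_contra hno
  push Not at hno
  classical
  haveI : Fintype Ω := Fintype.ofFinite Ω
  have e1 : Nat.card {v // bad v} = (Finset.univ.filter bad).card := by
    rw [Nat.card_eq_fintype_card, Fintype.card_subtype]
  have e2 : Nat.card {v // bad' v} = (Finset.univ.filter bad').card := by
    rw [Nat.card_eq_fintype_card, Fintype.card_subtype]
  have e3 : Nat.card Ω = (Finset.univ : Finset Ω).card := by
    rw [Nat.card_eq_fintype_card, Finset.card_univ]
  have hcover : (Finset.univ : Finset Ω) ⊆ Finset.univ.filter bad ∪ Finset.univ.filter bad' := by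
    intro u _
    rw [Finset.mem_union, Finset.mem_filter, Finset.mem_filter]
    by_cases hu : bad u
    · exact Or.inl ⟨Finset.mem_univ _, hu⟩
    · exact Or.inr ⟨Finset.mem_univ _, hno u hu⟩
  have hle := (Finset.card_le_card hcover).trans (Finset.card_union_le _ _)
  omega

/-- **S6d `stub_assemblyFields`** (registered signature, skeleton v6): from S4b's counts and S5b's family,
for a non-cube `m = decodeNat x` and admissible `K, K'`: (1) `h(K) = h(K')`; (2) the orders of the subgroups
generated by the degree-one classes above any list of primes `∤ 3m` agree. -/
theorem stub_assemblyFields :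
    (∃ C : ℕ, ∀ (K : Type) [Field K] [NumberField K],
      Module.finrank ℚ K = 3 → ∀ m : ℕ, (∀ r : ℕ, r ^ 3 ≠ m) → (∃ α : K, α ^ 3 = (m : K)) →
      ∀ X : ℕ, (27 * m ^ 2) ^ C ≤ X →
        X ≤ 4 * (Nat.log 2 X + 1) * Nat.card {p : ℕ // p.Prime ∧ p ≤ X ∧ ¬ p ∣ 3 * m} ∧
        ∀ T : ℕ, 600 * (Nat.log 2 X + 1) ^ 2 ≤ T →
          8 * Nat.card {v : Fin T → {p : ℕ // p.Prime ∧ p ≤ X ∧ ¬ p ∣ 3 * m} //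
              Subgroup.closure {c : ClassGroup (𝓞 K) | ∃ i : Fin T, ∃ P : Ideal (𝓞 K),
                ∃ hP : P ∈ nonZeroDivisors (Ideal (𝓞 K)),
                  P.IsPrime ∧ Ideal.absNorm P = (v i : ℕ) ∧ c = ClassGroup.mk0 ⟨P, hP⟩} ≠ ⊤} ≤
            Nat.card {p : ℕ // p.Prime ∧ p ≤ X ∧ ¬ p ∣ 3 * m} ^ T) →
    (IsQSolvable fun w => {y | ∀ (x : List Bool) (f a b : ℕ) (ps : List ℕ),
        w = boolPair x (boolPair (boolPair (encodeNat f) (boolPair (encodeNat a) (encodeNat b)))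
          (encodingListNatBool.encode ps)) →
        decodeNat x = f ^ 3 * (a * b ^ 2) → Squarefree (a * b) →
        ∀ (K : Type) [Field K] [NumberField K], Module.finrank ℚ K = 3 →
          (∀ r : ℕ, r ^ 3 ≠ decodeNat x) → (∃ α : K, α ^ 3 = (decodeNat x : K)) →
          (∀ p ∈ ps, p.Prime ∧ ¬ p ∣ 3 * decodeNat x) →
          ∃ t : List Bool, y = boolPair (encodeNat (Nat.card (Subgroup.closure
            {c : ClassGroup (𝓞 K) | ∃ p ∈ ps, ∃ P : Ideal (𝓞 K), ∃ hP : P ∈ nonZeroDivisors (Ideal (𝓞 K)),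
              P.IsPrime ∧ Ideal.absNorm P = p ∧ c = ClassGroup.mk0 ⟨P, hP⟩}))) t}) →
    ∀ x : List Bool, (∀ r : ℕ, r ^ 3 ≠ decodeNat x) →
      ∀ (K : Type) [Field K] [NumberField K] (K' : Type) [Field K'] [NumberField K'],
        Module.finrank ℚ K = 3 → (∃ α : K, α ^ 3 = (decodeNat x : K)) →
        Module.finrank ℚ K' = 3 → (∃ α' : K', α' ^ 3 = (decodeNat x : K')) →
        NumberField.classNumber K = NumberField.classNumber K' ∧
        ∀ ps : List ℕ, (∀ p ∈ ps, p.Prime ∧ ¬ p ∣ 3 * decodeNat x) →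
          Nat.card (Subgroup.closure {c : ClassGroup (𝓞 K) | ∃ p ∈ ps, ∃ P : Ideal (𝓞 K),
              ∃ hP : P ∈ nonZeroDivisors (Ideal (𝓞 K)), P.IsPrime ∧ Ideal.absNorm P = p ∧ c = ClassGroup.mk0 ⟨P, hP⟩}) =
            Nat.card (Subgroup.closure {c : ClassGroup (𝓞 K') | ∃ p ∈ ps, ∃ P : Ideal (𝓞 K'),
              ∃ hP : P ∈ nonZeroDivisors (Ideal (𝓞 K')), P.IsPrime ∧ Ideal.absNorm P = p ∧ c = ClassGroup.mk0 ⟨P, hP⟩}) := by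
  rintro ⟨C, hC⟩ ⟨F, -, -, hF⟩ x hnc K _ _ K' _ _ hK hα hK' hα'
  have hm0 : decodeNat x ≠ 0 := fun h => hnc 0 (by rw [h]; norm_num)
  -- (2) the core's answer is field-independent
  have hcard : ∀ ps : List ℕ, (∀ p ∈ ps, p.Prime ∧ ¬ p ∣ 3 * decodeNat x) →
      Nat.card (Subgroup.closure {c : ClassGroup (𝓞 K) | ∃ p ∈ ps, ∃ P : Ideal (𝓞 K),
          ∃ hP : P ∈ nonZeroDivisors (Ideal (𝓞 K)), P.IsPrime ∧ Ideal.absNorm P = p ∧ c = ClassGroup.mk0 ⟨P, hP⟩}) =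
        Nat.card (Subgroup.closure {c : ClassGroup (𝓞 K') | ∃ p ∈ ps, ∃ P : Ideal (𝓞 K'),
          ∃ hP : P ∈ nonZeroDivisors (Ideal (𝓞 K')), P.IsPrime ∧ Ideal.absNorm P = p ∧ c = ClassGroup.mk0 ⟨P, hP⟩}) := by
    intro ps hps
    obtain ⟨f, a, b, hfab, hsq⟩ := assemblyFields_cubefree _ hm0
    obtain ⟨y, hy⟩ := assemblyFields_nonempty (hF (boolPair x (boolPair (boolPair (encodeNat f)
      (boolPair (encodeNat a) (encodeNat b))) (encodingListNatBool.encode ps))))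
    obtain ⟨t, ht⟩ := hy x f a b ps rfl hfab hsq K hK hnc hα hps
    obtain ⟨t', ht'⟩ := hy x f a b ps rfl hfab hsq K' hK' hnc hα' hps
    have h := congrArg (fun s => decodeNat (boolUnpair s).1) (ht.symm.trans ht')
    simp only [boolUnpair_boolPair, Computability.decode_encodeNat] at h
    exact h
  refine ⟨?_, hcard⟩
  -- (1) class numbers agree: some tuple of good primes generates both class groups
  set m := decodeNat x with hm
  set X := (27 * m ^ 2) ^ C with hX
  set T := 600 * (Nat.log 2 X + 1) ^ 2 with hT
  obtain ⟨hdens, hgen⟩ := hC K hK m hnc hα X le_rfl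
  obtain ⟨-, hgen'⟩ := hC K' hK' m hnc hα' X le_rfl
  have hbad := hgen T le_rfl
  have hbad' := hgen' T le_rfl
  haveI := assemblyFields_finite X m
  have hGpos : 1 ≤ Nat.card {p : ℕ // p.Prime ∧ p ≤ X ∧ ¬ p ∣ 3 * m} := by
    by_contra h0
    push Not at h0
    rw [Nat.lt_one_iff.1 h0, mul_zero] at hdens
    have hX1 : 1 ≤ X := Nat.one_le_pow _ _ (Nat.mul_pos (by norm_num) (pow_pos (Nat.pos_of_ne_zero hm0) 2))
    omega
  have hΩ : Nat.card (Fin T → {p : ℕ // p.Prime ∧ p ≤ X ∧ ¬ p ∣ 3 * m}) =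
      Nat.card {p : ℕ // p.Prime ∧ p ≤ X ∧ ¬ p ∣ 3 * m} ^ T := by rw [Nat.card_fun, Nat.card_fin]
  have hΩpos : 1 ≤ Nat.card (Fin T → {p : ℕ // p.Prime ∧ p ≤ X ∧ ¬ p ∣ 3 * m}) := by
    rw [hΩ]; exact Nat.one_le_pow _ _ hGpos
  rw [← hΩ] at hbad hbad'
  obtain ⟨v, hv, hv'⟩ := assemblyFields_exists_good hΩpos hbad hbad'
  have hps : ∀ p ∈ List.ofFn (fun i => ((v i : ℕ))), p.Prime ∧ ¬ p ∣ 3 * decodeNat x := by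
    intro p hp
    obtain ⟨i, rfl⟩ := List.mem_ofFn.1 hp
    exact ⟨(v i).2.1, (v i).2.2.2⟩
  have h := hcard _ hps
  rw [← assemblyFields_countSet K v, ← assemblyFields_countSet K' v, not_not.1 hv, not_not.1 hv',
    assemblyFields_card_top, assemblyFields_card_top] at h
  exact h

end Summit.QuantumAdvantage.QuantumAdvantage.Theorems.LinnikCubicClassGroups
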